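import Summits.Langlands.Langlands.Theses.QuadraticWindow
import Summits.Langlands.Langlands.Theorems.QuadraticWindowHostInducedRepPatch
import Summits.Langlands.Langlands.Theorems.QuadraticWindowHostInducedRepPaneLaw
import Summits.Langlands.Langlands.Theorems.QuadraticWindowHostInducedRepGaloisOverKBridge
import Summits.Langlands.Langlands.Theorems.QuadraticWindowHostInducedRepTotallyRealInduction
import Summits.Langlands.Langlands.Theorems.QuadraticWindowHostInducedRepPackageCompose
import Summits.Langlands.Langlands.Theorems.QuadraticWindowHostInducedRepSignPin
import Summits.Langlands.Langlands.Theorems.QuadraticWindowHostInducedRepAsaiPoleInduced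
import Summits.Langlands.Langlands.Theorems.QuadraticWindowHostInducedRepPaneLawCont
import Summits.Langlands.Langlands.Theorems.QuadraticWindowHostInducedRepGaloisOverKCont
import Summits.Langlands.Langlands.Theorems.QuadraticWindowHostInducedRepPackageComposeCont
import Summits.Langlands.Langlands.Theorems.QuadraticWindowHostInducedRepAsaiTransferCont
import Literature.NumberTheory.Automorphic.AsaiSignCont
import Literature.NumberTheory.Automorphic.ReciprocityGLnPatchingFamily
import Literature.NumberTheory.Automorphic.AsaiSign
import Literature.NumberTheory.Automorphic.WeaklyRegularGaloisRep
import Literature.NumberTheory.Automorphic.ReciprocityGLn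
import Literature.NumberTheory.Automorphic.BaseChangeInductionAlong

/-!
# `HostInducedRep` from the published inputs of line `one-transparent-pane` (CONDITIONAL RESULT)
(crux `Summit.Langlands.Langlands.Theses.QuadraticWindow.HostInducedRep`, stmt-Langlands-10902)

`HostInducedRep_of_facts`: the crux follows from (i) twelve unproved PUBLISHED results, all but two already named
facts of the tree — lang.S27 (`exists_galoisRep_of_regularAlgebraic`), Fakhruddin–Pilloni Thm 9.10
(`FakhruddinPilloni2021_galoisRep_of_weaklyRegular_odd`), Jacquet–Shalika strong multiplicity one in pairing form
(`JacquetShalika1981_isEssConjSelfDual_of_isConjSelfDualAE`), placewise cyclic automorphic induction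
(`automorphicInduction_cyclic_cuspidal_unramified`), placewise cuspidal cyclic base change (Arthur–Clozel III Thm 4.2/5.1,
stated inline as a hypothesis), extension of unitary idele class characters (Hewitt–Ross (24.12), inline), archimedean base
change (`ArthurClozel1989_strongLifting_archimedean`), Henniart's infinity type of an automorphic induction
(`Henniart2012_infinityType_of_automorphicInduction`), existence of infinity types (`exists_hasInfinityType`), Artin
reciprocity at the real places (`artinReciprocity_character_archimedean`), existence of the (typed) Asai sign of a conjugate
self-dual cuspidal representation (Mok's dichotomy; Ramanujan-strength AS TYPED, see the currency caveat of the skeleton),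
the archimedean sign pin (`Mok2014_archimedean_parity_of_asaiSign`) — and (ii) the Asai-pole transfer through a
biquadratic tower (the registered stub `stub_asaiPoleInduced` of the line; proved in the lead's folder modulo Mok's
continuation dichotomy + Grbac–Shahidi 2015 Thm 4.3 + raw-product holomorphy; its landing replaces hypothesis (ii) by those
facts).  Every other step is a LANDED theorem: `stub_totallyRealInduction_cond`, `stub_paneLaw_cond`, `stub_package''`,
`stub_galoisOverK_cond`, `stub_patch`, `stub_signPin_cond`.  This is the line's deciding composition with its open inputs
as explicit hypotheses (the gate records a conditional result; the item stays open).
-/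

open scoped NumberField Polynomial Classical Topology -- `Classical`: the place subtypes indexing `mixedSpace K` are `Fintype` classically (`NormedCommRing (mixedSpace K)`)
open Literature.NumberTheory Literature.NumberTheory.Automorphic Literature.NumberTheory.GaloisRepresentations
open Literature.NumberTheory.GaloisRepresentations.QuadraticFamily
open IsDedekindDomain NumberField Filter Polynomial
open Summit.Langlands.Langlands.Theorems.HostInducedRep.GrsExplicitDescent
open Summit.Langlands.Langlands.Theorems.HostInducedRep.OneTransparentPane

set_option linter.dupNamespace false

namespace Summit.Langlands.Langlands.Theorems.HostInducedRep.OneTransparentPane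

/-- **`HostInducedRep` from the line's published inputs and the Asai transfer (CONDITIONAL).**  Hypotheses, in
order: lang.S27; Fakhruddin–Pilloni 9.10; Jacquet–Shalika SMO (pairing form); placewise cyclic AI; placewise cuspidal
cyclic BC; Hecke-character extension; archimedean BC; Henniart; existence of infinity types; Artin reciprocity at real
places; typed Asai-sign existence; Mok's archimedean sign pin; the Asai-pole transfer in a biquadratic tower.  Proof:
totally real `F` by induction of `r_{ℓ,ι}(π) ⊗ ẽψ`; otherwise pane law → laundering family → Fakhruddin–Pilloni per
member → Sorensen patching (all landed). [cite: Mok2014, Thm. 2.5.4 (a)] [cite: FakhruddinPilloni2021, Thm. 9.10]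
[cite: Sorensen2020, §1 Lemma 2] -/
theorem HostInducedRep_of_facts :
    (exists_galoisRep_of_regularAlgebraic) →
    (FakhruddinPilloni2021_galoisRep_of_weaklyRegular_odd) →
    (JacquetShalika1981_isEssConjSelfDual_of_isConjSelfDualAE) →
    (automorphicInduction_cyclic_cuspidal_unramified) →
    (∀ (n : ℕ) (F E : Type) [Field F] [NumberField F] [Field E] [NumberField E] [Algebra F E]
        [IsGalois F E], (Module.finrank F E).Prime →
        ∀ (hF : isCompact_glFiniteIntegralLevel n F) (π : CuspidalAutomorphicRepData n F hF),
          (∃ v : HeightOneSpectrum (𝓞 F), ¬ Algebra.IsUnramifiedIn (𝓞 E) v.asIdeal ∧ π.1.IsUnramifiedAt v) →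
          ∀ (hE : isCompact_glFiniteIntegralLevel n E),
            ∃ P : CuspidalAutomorphicRepData n E hE, IsUnramifiedBaseChangeLift π.1 P.1) →
    (∀ (F₀ K : Type) [Field F₀] [NumberField F₀] [Field K] [NumberField K] [Algebra F₀ K]
        (c : K ≃ₐ[F₀] K), Module.finrank F₀ K = 2 → c ≠ 1 →
        ∀ (χ₀ : HeckeCharacter F₀), χ₀.IsUnitary →
        ∀ (U : Set (HeightOneSpectrum (𝓞 K))),
          (∀ u ∈ U, c • u ∈ U → χ₀.IsUnramifiedAt (u.under (𝓞 F₀))) →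
          ∃ χ : HeckeCharacter K, χ.IsUnitary ∧
            (∀ x, χ (AdeleRing.ideleBaseChange F₀ K x) = χ₀ x) ∧ ∀ u ∈ U, χ.IsUnramifiedAt u) →
    (ArthurClozel1989_strongLifting_archimedean) →
    (Henniart2012_infinityType_of_automorphicInduction) →
    (∀ (N : ℕ) (K : Type) [Field K] [NumberField K] (hK : isCompact_glFiniteIntegralLevel N K)
        (P : AutomorphicRepData (AutomorphyDatum.gl N K hK)), P.exists_hasInfinityType) →
    (artinReciprocity_character_archimedean) →
    (∀ (F E : Type) [Field F] [NumberField F] [Field E] [NumberField E]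
        [Algebra F E] (c : E ≃ₐ[F] E), Module.finrank F E = 2 → c ≠ 1 →
        ∀ (N : ℕ) (hcpt : isCompact_glFiniteIntegralLevel N E) (P : CuspidalAutomorphicRepData N E hcpt),
          0 < N → P.1.IsConjSelfDualAE c → ∃ κ : ℤˣ, P.1.HasAsaiSign c κ) →
    (Mok2014_archimedean_parity_of_asaiSign) →
    (∀ (F₀ K F' L : Type) [Field F₀] [NumberField F₀] [Field K] [NumberField K]
          [Field F'] [NumberField F'] [Field L] [NumberField L]
          [Algebra F₀ K] [Algebra K L] [Algebra F' L] (cK : K ≃ₐ[F₀] K) (s : L ≃ₐ[F'] L),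
          Module.finrank F₀ K = 2 → Module.finrank K L = 2 → Module.finrank F' L = 2 → cK ≠ 1 → s ≠ 1 →
          (∀ x : K, s (algebraMap K L x) = algebraMap K L (cK x)) →
        ∀ (n : ℕ) (hL : isCompact_glFiniteIntegralLevel n L)
          (hK : isCompact_glFiniteIntegralLevel (2 * n) K)
          (P : CuspidalAutomorphicRepData n L hL) (Q : CuspidalAutomorphicRepData (2 * n) K hK),
          0 < n → IsAutomorphicInductionAlong P.1 Q.1 → P.1.IsConjSelfDualAE s → Q.1.IsConjSelfDualAE cK →
          ∀ ε : ℤˣ, Q.1.HasAsaiPole cK ε ↔ P.1.HasAsaiPole s ε) →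
    Summit.Langlands.Langlands.Theses.QuadraticWindow.HostInducedRep := by
  intro stub_factS27 stub_factFP stub_factSMO stub_factAI stub_factBC stub_factExt stub_factArchBC stub_factHen
    stub_factInf stub_factCFTarch stub_factAsaiSignExists stub_factSignPin stub_asaiPoleInduced F₀ F _ _ _ _ _ τ
    hTR hdeg hτ n hcpt π e k hreg hpol hpar hodd ℓ _ ι hℓ hunr eψ hψunr hψpar hψnti
  by_cases hF : NumberField.IsTotallyReal F
  · exact stub_totallyRealInduction_cond stub_factS27 F₀ F n hcpt π ℓ ι eψ hF hdeg hreg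
  have hH : Hyps τ n π e k ℓ eψ :=
    ⟨hTR, hdeg, hτ, hreg, hpol, hpar, hodd, hℓ, hunr, hψunr, hψpar, hψnti⟩
  have hpin := stub_signPin_cond stub_factSignPin
  have hpane := stub_paneLaw_cond stub_factAsaiSignExists hpin stub_asaiPoleInduced
  obtain ⟨m, B, hm, hB, hK, τ', T, ψ₁, hsix, hdict, hcov⟩ :=
    stub_package'' stub_factAI stub_factBC stub_factExt stub_factArchBC stub_factHen stub_factInf
      stub_factCFTarch stub_factAsaiSignExists hpin hpane F₀ F τ n hcpt π e k ℓ ι eψ hH hF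
  -- the ℓ-adic representation of each member
  have hr : ∀ D : GoodPrime F₀ m B, ∃ r : FramedGaloisRep (sqrtNegField F₀ D.1) (PadicAlgCl ℓ) (2 * n),
      r.toGaloisRep.IsSemisimple ∧
        ∀ (u : HeightOneSpectrum (𝓞 (sqrtNegField F₀ D.1))) (β : Multiset ℂ),
          ((ℓ : ℕ) : 𝓞 (sqrtNegField F₀ D.1)) ∉ u.asIdeal → (τ' D).1.HasSatakeParamAt u β →
          (ψ₁ D).IsUnramifiedAt u →
            r.IsUnramifiedAt u ∧ r.HasFrobCharpolyAt u (arithFrobPolyOfSatake ι u.residueCard (2 * n)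
              (β.map (fun b ↦ b * ((ψ₁ D).valueAtUniformizer u)⁻¹))) := by
    intro D
    haveI : IsCMField (sqrtNegField F₀ D.1) := GoodPrime.isCMField (Or.inl hTR) D
    obtain ⟨h1, h2, h3, h4, h5, h6⟩ := hsix D
    exact stub_galoisOverK_cond stub_factFP stub_factSMO (2 * n) (sqrtNegField F₀ D.1) (hK D) (τ' D) (T D)
      (ψ₁ D) h1 h2 h3 h4 h5 h6 ℓ ι
  choose r hrss hrloc using hr
  refine stub_patch F₀ F n hcpt π ℓ ι eψ m B hm hB r hrss (fun D ↦ ?_) ?_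
  · filter_upwards [hdict D] with u hu v α c huv hv hg
    obtain ⟨hℓu, hψu, β, hβ, heq⟩ := hu v α c huv hv hg
    obtain ⟨hunr', hchar⟩ := hrloc D u β hℓu hβ hψu
    exact ⟨hunr', heq ▸ hchar⟩
  · intro v α c hv hg
    obtain ⟨D, hsplit, u, huv, hℓu, hψu, β, hβ, heq⟩ := hcov v α c hv hg
    obtain ⟨hunr', hchar⟩ := hrloc D u β hℓu hβ hψu
    exact ⟨D, hsplit, u, huv, hunr', heq ▸ hchar⟩

/-- **`HostInducedRep` from PUBLISHED facts plus ONE explicit Ramanujan-strength hypothesis (CONDITIONAL, v2).**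
Supersedes `HostInducedRep_of_facts` now that the Asai-pole transfer is LANDED (`stub_asaiPoleInduced_cond`,
…AsaiPoleInduced.lean): hypotheses, in order — lang.S27; Fakhruddin–Pilloni 9.10; Jacquet–Shalika SMO (pairing
form); placewise cyclic AI; placewise cuspidal cyclic BC; Hecke-character extension; archimedean BC; Henniart;
existence of infinity types; Artin reciprocity at real places; Mok's archimedean sign pin; Mok's Asai-pole
dichotomy in CONTINUATION form (verbatim `Mok2014_partialAsaiL_continuation_pole_dichotomy` of `AsaiSignCont`);
Grbac–Shahidi's behaviour of continued partial Asai `L`-functions at `s = 1` — ALL published — and last the ONLY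
unpublished input: holomorphy of the RAW partial Asai Euler products on `{1 < Re s}` (⇐ Ramanujan; it is there
solely because the tree's `HasAsaiPole`/`HasAsaiSign` are raw Euler-product limits).  Inside: the raw Asai-sign
existence and the transfer are DERIVED (identity theorem, `tendsto_nhdsWithin_one_lt_re_of_continuation`), then
the composition of the landed stubs as in `HostInducedRep_of_facts`. [cite: Mok2014, Thm. 2.5.4 (a)]
[cite: GrbacShahidi2015, Thm. 4.3] [cite: FakhruddinPilloni2021, Thm. 9.10] [cite: Sorensen2020, §1 Lemma 2] -/
theorem HostInducedRep_of_publishedFacts :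
    (exists_galoisRep_of_regularAlgebraic) →
    (FakhruddinPilloni2021_galoisRep_of_weaklyRegular_odd) →
    (JacquetShalika1981_isEssConjSelfDual_of_isConjSelfDualAE) →
    (automorphicInduction_cyclic_cuspidal_unramified) →
    (∀ (n : ℕ) (F E : Type) [Field F] [NumberField F] [Field E] [NumberField E] [Algebra F E]
        [IsGalois F E], (Module.finrank F E).Prime →
        ∀ (hF : isCompact_glFiniteIntegralLevel n F) (π : CuspidalAutomorphicRepData n F hF),
          (∃ v : HeightOneSpectrum (𝓞 F), ¬ Algebra.IsUnramifiedIn (𝓞 E) v.asIdeal ∧ π.1.IsUnramifiedAt v) →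
          ∀ (hE : isCompact_glFiniteIntegralLevel n E),
            ∃ P : CuspidalAutomorphicRepData n E hE, IsUnramifiedBaseChangeLift π.1 P.1) →
    (∀ (F₀ K : Type) [Field F₀] [NumberField F₀] [Field K] [NumberField K] [Algebra F₀ K]
        (c : K ≃ₐ[F₀] K), Module.finrank F₀ K = 2 → c ≠ 1 →
        ∀ (χ₀ : HeckeCharacter F₀), χ₀.IsUnitary →
        ∀ (U : Set (HeightOneSpectrum (𝓞 K))),
          (∀ u ∈ U, c • u ∈ U → χ₀.IsUnramifiedAt (u.under (𝓞 F₀))) →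
          ∃ χ : HeckeCharacter K, χ.IsUnitary ∧
            (∀ x, χ (AdeleRing.ideleBaseChange F₀ K x) = χ₀ x) ∧ ∀ u ∈ U, χ.IsUnramifiedAt u) →
    (ArthurClozel1989_strongLifting_archimedean) →
    (Henniart2012_infinityType_of_automorphicInduction) →
    (∀ (N : ℕ) (K : Type) [Field K] [NumberField K] (hK : isCompact_glFiniteIntegralLevel N K)
        (P : AutomorphicRepData (AutomorphyDatum.gl N K hK)), P.exists_hasInfinityType) →
    (artinReciprocity_character_archimedean) →
    (Mok2014_archimedean_parity_of_asaiSign) →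
    Mok2014_partialAsaiL_continuation_pole_dichotomy →
    (∀ (F E : Type) [Field F] [NumberField F] [Field E] [NumberField E] [Algebra F E] (c : E ≃ₐ[F] E),
        Module.finrank F E = 2 → c ≠ 1 →
        ∀ (N : ℕ) (hcpt : isCompact_glFiniteIntegralLevel N E) (π : CuspidalAutomorphicRepData N E hcpt),
          0 < N →
          (∀ᶠ w : HeightOneSpectrum (𝓞 E) in cofinite, ∀ α : Multiset ℂ,
            π.1.HasSatakeParamAt w α → ‖α.prod‖ = 1) →
          ∀ (S : Set (HeightOneSpectrum (𝓞 F))) (A : SatakeFamily E) (η : ℤˣ), π.1.IsAsaiDatum c S A →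
            ∃ σ₀ : ℝ, 1 ≤ σ₀ ∧
              (∀ s : ℂ, σ₀ < s.re →
                Multipliable fun v : {v : HeightOneSpectrum (𝓞 F) // v ∉ S} =>
                  ((asaiLocalPolynomial c A η (placeAbove E v.1)).eval ((v.1.residueCard : ℂ) ^ (-s)))⁻¹) ∧
              ∃ (k : ℕ) (δ : ℝ) (G : ℂ → ℂ), k ≤ 1 ∧ 0 < δ ∧
                DifferentiableOn ℂ G ({s : ℂ | 1 < s.re} ∪ Metric.ball 1 δ) ∧
                (∀ s : ℂ, σ₀ < s.re → G s = (s - 1) ^ k * partialAsaiL S c A η s) ∧ G 1 ≠ 0) →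
    (∀ (F E : Type) [Field F] [NumberField F] [Field E] [NumberField E] [Algebra F E]
        (c : E ≃ₐ[F] E), Module.finrank F E = 2 → c ≠ 1 →
        ∀ (N : ℕ) (hcpt : isCompact_glFiniteIntegralLevel N E) (π : CuspidalAutomorphicRepData N E hcpt),
          0 < N →
          (∀ᶠ w : HeightOneSpectrum (𝓞 E) in cofinite, ∀ α : Multiset ℂ,
            π.1.HasSatakeParamAt w α → ‖α.prod‖ = 1) →
          ∀ (S : Set (HeightOneSpectrum (𝓞 F))) (A : SatakeFamily E) (θ : ℤˣ), π.1.IsAsaiDatum c S A →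
            DifferentiableOn ℂ (partialAsaiL S c A θ) {s : ℂ | 1 < s.re}) →
    Summit.Langlands.Langlands.Theses.QuadraticWindow.HostInducedRep := by
  intro stub_factS27 stub_factFP stub_factSMO stub_factAI stub_factBC stub_factExt stub_factArchBC stub_factHen
    stub_factInf stub_factCFTarch stub_factSignPin stub_factMokCont stub_factGS stub_hypRawAsaiHolomorphy
  have rawAsaiSign_exists : ∀ (F E : Type) [Field F] [NumberField F] [Field E] [NumberField E] [Algebra F E]
      (c : E ≃ₐ[F] E), Module.finrank F E = 2 → c ≠ 1 →
      ∀ (N : ℕ) (hcpt : isCompact_glFiniteIntegralLevel N E) (π : CuspidalAutomorphicRepData N E hcpt),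
        0 < N → π.1.IsConjSelfDualAE c →
        ∃ η : ℤˣ, π.1.HasAsaiPole c η ∧
          ∀ (S : Set (HeightOneSpectrum (𝓞 F))) (A : SatakeFamily E), π.1.IsAsaiDatum c S A →
            ∃ r : ℂ, Tendsto (partialAsaiL S c A (-η)) (𝓝[{s : ℂ | 1 < s.re}] 1) (𝓝 r) := by
    intro F E _ _ _ _ _ c h2 hc N hcpt π hN hπ
    obtain ⟨η, hη⟩ := stub_factMokCont F E c h2 hc N hcpt π hN hπ
    have hunit := eventually_norm_prod_eq_one_of_isConjSelfDualAE hN π hπ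
    refine ⟨η, fun S A hSA => ?_, fun S A hSA => ?_⟩
    · -- raw simple pole: the continuation `G` of `(s - 1) L^S` and raw holomorphy on `{1 < Re s}`
      obtain ⟨σ₀, hσ₀, -, ⟨G, hG, hGL, hG1⟩, -⟩ := hη S A hSA
      have hf : DifferentiableOn ℂ (fun s => (s - 1) * partialAsaiL S c A η s) {s : ℂ | 1 < s.re} :=
        (differentiableOn_id.sub_const 1).mul (stub_hypRawAsaiHolomorphy F E c h2 hc N hcpt π hN hunit S A η hSA)
      exact ⟨G 1, hG1, tendsto_nhdsWithin_one_lt_re_of_continuation hσ₀ hG hf hGL⟩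
    · -- raw finite limit for the other sign: the continuation `H` of `L^S(·, As^{-η})`
      obtain ⟨σ₀, hσ₀, -, -, ⟨H, hH, hHL, -⟩⟩ := hη S A hSA
      exact ⟨H 1, tendsto_nhdsWithin_one_lt_re_of_continuation hσ₀ hH
        (stub_hypRawAsaiHolomorphy F E c h2 hc N hcpt π hN hunit S A (-η) hSA) hHL⟩
  have asaiSignExists : ∀ (F E : Type) [Field F] [NumberField F] [Field E] [NumberField E]
      [Algebra F E] (c : E ≃ₐ[F] E), Module.finrank F E = 2 → c ≠ 1 →
      ∀ (N : ℕ) (hcpt : isCompact_glFiniteIntegralLevel N E) (P : CuspidalAutomorphicRepData N E hcpt),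
        0 < N → P.1.IsConjSelfDualAE c → ∃ κ : ℤˣ, P.1.HasAsaiSign c κ := by
    intro F E _ _ _ _ _ c h2 hc N hcpt P hN hP
    obtain ⟨η, hη, -⟩ := rawAsaiSign_exists F E c h2 hc N hcpt P hN hP
    exact ⟨(-1) ^ (N + 1) * η, (P.1.hasAsaiPole_iff_hasAsaiSign c η).mp hη⟩
  have asaiPoleInduced :
      ∀ (F₀ K F' L : Type) [Field F₀] [NumberField F₀] [Field K] [NumberField K]
        [Field F'] [NumberField F'] [Field L] [NumberField L]
        [Algebra F₀ K] [Algebra K L] [Algebra F' L] (cK : K ≃ₐ[F₀] K) (s : L ≃ₐ[F'] L),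
        Module.finrank F₀ K = 2 → Module.finrank K L = 2 → Module.finrank F' L = 2 → cK ≠ 1 → s ≠ 1 →
        (∀ x : K, s (algebraMap K L x) = algebraMap K L (cK x)) →
      ∀ (n : ℕ) (hL : isCompact_glFiniteIntegralLevel n L)
        (hK : isCompact_glFiniteIntegralLevel (2 * n) K)
        (P : CuspidalAutomorphicRepData n L hL) (Q : CuspidalAutomorphicRepData (2 * n) K hK),
        0 < n → IsAutomorphicInductionAlong P.1 Q.1 → P.1.IsConjSelfDualAE s → Q.1.IsConjSelfDualAE cK →
        ∀ ε : ℤˣ, Q.1.HasAsaiPole cK ε ↔ P.1.HasAsaiPole s ε :=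
    stub_asaiPoleInduced_cond rawAsaiSign_exists stub_factGS stub_hypRawAsaiHolomorphy
  intro F₀ F _ _ _ _ _ τ hTR hdeg hτ n hcpt π e k hreg hpol hpar hodd ℓ _ ι hℓ hunr eψ hψunr hψpar hψnti
  by_cases hF : NumberField.IsTotallyReal F
  · exact stub_totallyRealInduction_cond stub_factS27 F₀ F n hcpt π ℓ ι eψ hF hdeg hreg
  have hH : Hyps τ n π e k ℓ eψ :=
    ⟨hTR, hdeg, hτ, hreg, hpol, hpar, hodd, hℓ, hunr, hψunr, hψpar, hψnti⟩
  have hpin := stub_signPin_cond stub_factSignPin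
  have hpane := stub_paneLaw_cond asaiSignExists hpin asaiPoleInduced
  obtain ⟨m, B, hm, hB, hK, τ', T, ψ₁, hsix, hdict, hcov⟩ :=
    stub_package'' stub_factAI stub_factBC stub_factExt stub_factArchBC stub_factHen stub_factInf
      stub_factCFTarch asaiSignExists hpin hpane F₀ F τ n hcpt π e k ℓ ι eψ hH hF
  -- the ℓ-adic representation of each member
  have hr : ∀ D : GoodPrime F₀ m B, ∃ r : FramedGaloisRep (sqrtNegField F₀ D.1) (PadicAlgCl ℓ) (2 * n),
      r.toGaloisRep.IsSemisimple ∧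
        ∀ (u : HeightOneSpectrum (𝓞 (sqrtNegField F₀ D.1))) (β : Multiset ℂ),
          ((ℓ : ℕ) : 𝓞 (sqrtNegField F₀ D.1)) ∉ u.asIdeal → (τ' D).1.HasSatakeParamAt u β →
          (ψ₁ D).IsUnramifiedAt u →
            r.IsUnramifiedAt u ∧ r.HasFrobCharpolyAt u (arithFrobPolyOfSatake ι u.residueCard (2 * n)
              (β.map (fun b ↦ b * ((ψ₁ D).valueAtUniformizer u)⁻¹))) := by
    intro D
    haveI : IsCMField (sqrtNegField F₀ D.1) := GoodPrime.isCMField (Or.inl hTR) D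
    obtain ⟨h1, h2, h3, h4, h5, h6⟩ := hsix D
    exact stub_galoisOverK_cond stub_factFP stub_factSMO (2 * n) (sqrtNegField F₀ D.1) (hK D) (τ' D) (T D)
      (ψ₁ D) h1 h2 h3 h4 h5 h6 ℓ ι
  choose r hrss hrloc using hr
  refine stub_patch F₀ F n hcpt π ℓ ι eψ m B hm hB r hrss (fun D ↦ ?_) ?_
  · filter_upwards [hdict D] with u hu v α c huv hv hg
    obtain ⟨hℓu, hψu, β, hβ, heq⟩ := hu v α c huv hv hg
    obtain ⟨hunr', hchar⟩ := hrloc D u β hℓu hβ hψu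
    exact ⟨hunr', heq ▸ hchar⟩
  · intro v α c hv hg
    obtain ⟨D, hsplit, u, huv, hℓu, hψu, β, hβ, heq⟩ := hcov v α c hv hg
    obtain ⟨hunr', hchar⟩ := hrloc D u β hℓu hβ hψu
    exact ⟨D, hsplit, u, huv, hunr', heq ▸ hchar⟩


/-! ## Appended 2026-08-16 (lead, wave 4): the conditional result on PUBLISHED facts only -/

/-- **`HostInducedRep` from PUBLISHED facts ONLY (CONDITIONAL, v3 — no Ramanujan-strength hypothesis).**
Supersedes `HostInducedRep_of_publishedFacts`: the whole Asai-sign chain now runs in the continuation-form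
currency of `AsaiSignCont.lean` (`stub_paneLaw_cont`, `asaiPoleTransfer_cont`, `stub_memberSign_cont`,
`stub_package_cont`, `stub_galoisOverK_cont`), so the raw-product holomorphy hypothesis of v2 is gone.
Hypotheses, in order, ALL published theorems rendered as named facts of the tree (or their verbatim bodies:
the two continuation-currency facts, whose Literature modules are newer than this file's imports, and the three
facts the tree has no name for): lang.S27 (`exists_galoisRep_of_regularAlgebraic`); Fakhruddin–Pilloni 9.10 with oddness
in continuation form (`FakhruddinPilloni2021_galoisRep_of_weaklyRegular_oddCont`); Jacquet–Shalika SMO, pairing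
form (`JacquetShalika1981_isEssConjSelfDual_of_isConjSelfDualAE`); placewise cyclic automorphic induction
(`automorphicInduction_cyclic_cuspidal_unramified`); placewise cuspidal cyclic base change of prime degree
(Arthur–Clozel III Thm. 4.2/5.1, body); extension of unitary Hecke characters along a quadratic extension with
prescribed unramifiedness (Hewitt–Ross (24.12), body); archimedean base change
(`ArthurClozel1989_strongLifting_archimedean`); Henniart's infinity type of an automorphic induction
(`Henniart2012_infinityType_of_automorphicInduction`); existence of infinity types (Clozel 1990 §3.3, body
`exists_hasInfinityType`); Artin reciprocity for characters at real places
(`artinReciprocity_character_archimedean`); Mok's archimedean sign pin, continuation form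
(`Mok2014_archimedean_parity_of_asaiSignCont`); Mok's Asai-pole dichotomy, continuation form
(`Mok2014_partialAsaiL_continuation_pole_dichotomy`); Grbac–Shahidi's behaviour of continued partial Asai
`L`-functions at `s = 1` (`GrbacShahidi2015_partialAsaiL_at_one`).  Proof: the composition of the landed stubs
(`stub_totallyRealInduction_cond`, `stub_paneLaw_cont`, `asaiPoleTransfer_cont`, `stub_package_cont`,
`stub_galoisOverK_cont`, `stub_patch`). [cite: Mok2014, Thm. 2.5.4 (a) and Cor. 2.5.5]
[cite: GrbacShahidi2015, Thm. 4.3] [cite: FakhruddinPilloni2021, Thm. 9.10] [cite: Sorensen2020, §1 Lemma 2] -/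
theorem HostInducedRep_of_publishedFactsCont :
    exists_galoisRep_of_regularAlgebraic →
    (∀ (n : ℕ) (K : Type) [Field K] [NumberField K] [IsCMField K]
        (hcpt : isCompact_glFiniteIntegralLevel n K) (π : CuspidalAutomorphicRepData n K hcpt)
        (T : InfinityType K n), π.1.HasInfinityType T → T.IsCAlgebraic → T.IsWeaklyRegular →
          π.1.IsEssConjSelfDual 1 → π.1.HasAsaiSignCont (NumberField.IsCMField.complexConj K) 1 →
            ∀ (ℓ : ℕ) [Fact ℓ.Prime] (ι : PadicAlgCl ℓ ≃+* ℂ),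
              ∃ r : GaloisRepresentations.FramedGaloisRep K (PadicAlgCl ℓ) n,
                ∀ (v : HeightOneSpectrum (𝓞 K)) (α : Multiset ℂ), π.1.HasSatakeParamAt v α →
                  ((ℓ : ℕ) : 𝓞 K) ∉ v.asIdeal →
                    r.IsUnramifiedAt v ∧
                      r.HasFrobCharpolyAt v (arithFrobPolyOfSatake ι v.residueCard n α)) →
    JacquetShalika1981_isEssConjSelfDual_of_isConjSelfDualAE →
    automorphicInduction_cyclic_cuspidal_unramified →
    (∀ (n : ℕ) (F E : Type) [Field F] [NumberField F] [Field E] [NumberField E] [Algebra F E]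
        [IsGalois F E], (Module.finrank F E).Prime →
        ∀ (hF : isCompact_glFiniteIntegralLevel n F) (π : CuspidalAutomorphicRepData n F hF),
          (∃ v : HeightOneSpectrum (𝓞 F), ¬ Algebra.IsUnramifiedIn (𝓞 E) v.asIdeal ∧ π.1.IsUnramifiedAt v) →
          ∀ (hE : isCompact_glFiniteIntegralLevel n E),
            ∃ P : CuspidalAutomorphicRepData n E hE, IsUnramifiedBaseChangeLift π.1 P.1) →
    (∀ (F₀ K : Type) [Field F₀] [NumberField F₀] [Field K] [NumberField K] [Algebra F₀ K]
        (c : K ≃ₐ[F₀] K), Module.finrank F₀ K = 2 → c ≠ 1 →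
        ∀ (χ₀ : HeckeCharacter F₀), χ₀.IsUnitary →
        ∀ (U : Set (HeightOneSpectrum (𝓞 K))),
          (∀ u ∈ U, c • u ∈ U → χ₀.IsUnramifiedAt (u.under (𝓞 F₀))) →
          ∃ χ : HeckeCharacter K, χ.IsUnitary ∧
            (∀ x, χ (AdeleRing.ideleBaseChange F₀ K x) = χ₀ x) ∧ ∀ u ∈ U, χ.IsUnramifiedAt u) →
    ArthurClozel1989_strongLifting_archimedean →
    Henniart2012_infinityType_of_automorphicInduction →
    (∀ (N : ℕ) (K : Type) [Field K] [NumberField K] (hK : isCompact_glFiniteIntegralLevel N K)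
        (P : AutomorphicRepData (AutomorphyDatum.gl N K hK)), P.exists_hasInfinityType) →
    artinReciprocity_character_archimedean →
    (∀ (F E : Type) [Field F] [NumberField F] [Field E] [NumberField E] [Algebra F E]
        (c : E ≃ₐ[F] E), Module.finrank F E = 2 → c ≠ 1 →
        ∀ (N : ℕ) (hcpt : isCompact_glFiniteIntegralLevel N E) (P : CuspidalAutomorphicRepData N E hcpt)
          (κ : ℤˣ) (χ : (E →+* ℂ) → Multiset ℂ) (σ : E →+* ℂ) (r : ℝ),
          0 < N → P.1.IsConjSelfDualAE c → P.1.HasAsaiSignCont c κ → P.1.HasArchParameter χ →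
          NumberField.ComplexEmbedding.IsConj σ c → (χ σ).Nodup →
          (∀ a ∈ χ σ, ∃ m : ℤ, a = (m : ℂ) + (r : ℂ)) →
          ∀ a ∈ χ σ, ∃ m : ℤ, a = (m : ℂ) + ((N : ℂ) - 1) / 2 + (1 - ((κ : ℤ) : ℂ)) / 4) →
    Mok2014_partialAsaiL_continuation_pole_dichotomy →
    GrbacShahidi2015_partialAsaiL_at_one →
    Summit.Langlands.Langlands.Theses.QuadraticWindow.HostInducedRep := by
  intro stub_factS27 stub_factFPCont stub_factSMO stub_factAI stub_factBC stub_factExt stub_factArchBC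
    stub_factHen stub_factInf stub_factCFTarch stub_factSignPinCont stub_factMokCont stub_factGS
  have asaiSignExistsCont : ∀ (F E : Type) [Field F] [NumberField F] [Field E] [NumberField E]
      [Algebra F E] (c : E ≃ₐ[F] E), Module.finrank F E = 2 → c ≠ 1 →
      ∀ (N : ℕ) (hcpt : isCompact_glFiniteIntegralLevel N E) (P : CuspidalAutomorphicRepData N E hcpt),
        0 < N → P.1.IsConjSelfDualAE c → ∃ κ : ℤˣ, P.1.HasAsaiSignCont c κ :=
    fun _ _ _ _ _ _ _ _ h2 hc _ _ P hN hP => P.exists_hasAsaiSignCont stub_factMokCont h2 hc hN hP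
  intro F₀ F _ _ _ _ _ τ hTR hdeg hτ n hcpt π e k hreg hpol hpar hodd ℓ _ ι hℓ hunr eψ hψunr hψpar hψnti
  by_cases hF : NumberField.IsTotallyReal F
  · exact stub_totallyRealInduction_cond stub_factS27 F₀ F n hcpt π ℓ ι eψ hF hdeg hreg
  have hH : Hyps τ n π e k ℓ eψ :=
    ⟨hTR, hdeg, hτ, hreg, hpol, hpar, hodd, hℓ, hunr, hψunr, hψpar, hψnti⟩
  have hpane := stub_paneLaw_cont asaiSignExistsCont stub_factSignPinCont
    (asaiPoleTransfer_cont stub_factMokCont stub_factGS)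
  obtain ⟨m, B, hm, hB, hK, τ', T, ψ₁, hsix, hdict, hcov⟩ :=
    stub_package_cont stub_factAI stub_factBC stub_factExt stub_factArchBC stub_factHen stub_factInf
      stub_factCFTarch asaiSignExistsCont stub_factSignPinCont hpane F₀ F τ n hcpt π e k ℓ ι eψ hH hF
  -- the ℓ-adic representation of each member
  have hr : ∀ D : GoodPrime F₀ m B, ∃ r : FramedGaloisRep (sqrtNegField F₀ D.1) (PadicAlgCl ℓ) (2 * n),
      r.toGaloisRep.IsSemisimple ∧
        ∀ (u : HeightOneSpectrum (𝓞 (sqrtNegField F₀ D.1))) (β : Multiset ℂ),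
          ((ℓ : ℕ) : 𝓞 (sqrtNegField F₀ D.1)) ∉ u.asIdeal → (τ' D).1.HasSatakeParamAt u β →
          (ψ₁ D).IsUnramifiedAt u →
            r.IsUnramifiedAt u ∧ r.HasFrobCharpolyAt u (arithFrobPolyOfSatake ι u.residueCard (2 * n)
              (β.map (fun b ↦ b * ((ψ₁ D).valueAtUniformizer u)⁻¹))) := by
    intro D
    haveI : IsCMField (sqrtNegField F₀ D.1) := GoodPrime.isCMField (Or.inl hTR) D
    obtain ⟨h1, h2, h3, h4, h5, h6⟩ := hsix D
    exact stub_galoisOverK_cont stub_factFPCont stub_factSMO (2 * n) (sqrtNegField F₀ D.1) (hK D) (τ' D) (T D)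
      (ψ₁ D) h1 h2 h3 h4 h5 h6 ℓ ι
  choose r hrss hrloc using hr
  refine stub_patch F₀ F n hcpt π ℓ ι eψ m B hm hB r hrss (fun D ↦ ?_) ?_
  · filter_upwards [hdict D] with u hu v α c huv hv hg
    obtain ⟨hℓu, hψu, β, hβ, heq⟩ := hu v α c huv hv hg
    obtain ⟨hunr', hchar⟩ := hrloc D u β hℓu hβ hψu
    exact ⟨hunr', heq ▸ hchar⟩
  · intro v α c hv hg
    obtain ⟨D, hsplit, u, huv, hℓu, hψu, β, hβ, heq⟩ := hcov v α c hv hg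
    obtain ⟨hunr', hchar⟩ := hrloc D u β hℓu hβ hψu
    exact ⟨D, hsplit, u, huv, hunr', heq ▸ hchar⟩

end Summit.Langlands.Langlands.Theorems.HostInducedRep.OneTransparentPane
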